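import Mathlib
import HarnessLib
import Literature.Analysis.ValidatedNumerics.FixedPointInterval

/-!
# Crux K1b-DR (stmt-NavierStokesRegularity-23954), line `taylor-model` — certificate SOUNDNESS tooling: the ROUNDED-DYADIC
# FLOATING INTERVAL layer `IntervalD`, part 1 (S1-VECTOR-23954 §3 / §5.3 (f) / §5.5 (ii); director ruling dss_58 (A))

The v3 (componentwise) checker of the Taylor-model chain certificate replaces exact `ℚ(√2)` arithmetic in the enclosure
clauses by OUTWARD-ROUNDED interval arithmetic on DYADIC FLOATING numbers `m · 2^e` (`Dyad`: integer mantissa and exponent);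
an interval is a pair of such numbers (`IntervalD`), and every operation may be followed by `roundOut prec`, which shifts the
mantissas down to at most `prec` bits — the lower endpoint by FLOOR, the upper by CEILING — so that mantissas stay machine-sized
(`prec = 64` per the ruling) at uniform RELATIVE precision across the `2^{±40}` range of the cascade clocks (the tree's
fixed-point engines `ValidatedNumerics.Numerics.FI` / `NumericsMP.MI` round at an absolute grid; their floor/ceiling-division
and four-corner lemmas are reused). This part: `Dyad` with exact `neg/add/sub/mul/shift/abs/min/max`, decidable `ble/blt`
(exponent alignment), directed roundings `roundDown/roundUp` (`roundDown_le`, `le_roundUp`); `IntervalD` with `mem x I`, the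
ONE rounding lemma `mem_roundOut`, exact `neg/add/sub/mul` (Moore) `/sqr/mulDyad/shift/hull`, fused rounded `addR/subR/mulR/
sqrR`, and the Boolean tests `subset/hiLe/leLo` and the bound `mag`, each with its inclusion theorem against `ℝ`
(`Dyad.toReal`). Part 2 (`…IntervalDEnclose.lean`): rounded `divNat`, `powR` and the enclosures `ofRat`, `sqrt2`, `ofQS2`.
Everything computes on `ℤ`/`ℕ` (`Nat.pow`, `Int.shiftRight`, `Nat.log2`), so closed tests evaluate by `decide +kernel`.
References: R. E. Moore, *Interval Analysis* (1966) Ch. 2–4; G. Alefeld, J. Herzberger, *Introduction to Interval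
Computations* (1983) Ch. 4, eq. (8) and Thm 3 (directed roundings generate an interval rounding; inclusion) — recorded in
`Literature/Analysis/ValidatedNumerics/MachineIntervalArithmetic.lean`. [folklore]
MODEL-lattice bookkeeping only (rung TL-M3, one finite-dimensional model ODE); nothing here concerns the Navier–Stokes equations.
-/

-- the sub-problem namespace repeats the summit name by design (D-0017)
set_option linter.dupNamespace false

namespace Summit.NavierStokesRegularity.NavierStokesRegularity.Theorems.TaylorModelCert

open Literature.Analysis.ValidatedNumerics

/-! ### Dyadic floating numbers -/

/-- A dyadic floating number `m · 2^e` (integer mantissa `m`, integer exponent `e`; no normalisation). [folklore] -/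
structure Dyad where
  /-- mantissa -/
  m : ℤ
  /-- binary exponent -/
  e : ℤ
  deriving DecidableEq, Repr

namespace Dyad

/-- The real number `m · 2^e`. [folklore] -/
noncomputable def toReal (d : Dyad) : ℝ := (d.m : ℝ) * (2 : ℝ) ^ d.e

/-- The integer `z` as a dyadic number. [folklore] -/
def ofInt (z : ℤ) : Dyad := ⟨z, 0⟩

/-- Negation (exact). [folklore] -/
def neg (d : Dyad) : Dyad := ⟨-d.m, d.e⟩

/-- Rescaling by `2^k` (exact). [folklore] -/
def shift (d : Dyad) (k : ℤ) : Dyad := ⟨d.m, d.e + k⟩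

/-- Absolute value (exact). [folklore] -/
def abs (d : Dyad) : Dyad := ⟨|d.m|, d.e⟩

/-- The mantissa of `d` re-expressed at an exponent `e ≤ d.e` (exact: `m · 2^(d.e - e)`; the power is a `Nat.pow`).
[folklore] -/
def mantAt (d : Dyad) (e : ℤ) : ℤ := d.m * ((2 ^ (d.e - e).toNat : ℕ) : ℤ)

/-- Sum (exact, at the smaller exponent). [folklore] -/
def add (a b : Dyad) : Dyad := ⟨a.mantAt (min a.e b.e) + b.mantAt (min a.e b.e), min a.e b.e⟩

/-- Difference (exact). [folklore] -/
def sub (a b : Dyad) : Dyad := add a (neg b)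

/-- Product (exact). [folklore] -/
def mul (a b : Dyad) : Dyad := ⟨a.m * b.m, a.e + b.e⟩

/-- Decidable `≤` (exact, by exponent alignment). [folklore] -/
def ble (a b : Dyad) : Bool := decide (a.mantAt (min a.e b.e) ≤ b.mantAt (min a.e b.e))

/-- Decidable `<` (exact). [folklore] -/
def blt (a b : Dyad) : Bool := decide (a.mantAt (min a.e b.e) < b.mantAt (min a.e b.e))

/-- Minimum (exact). [folklore] -/
def min (a b : Dyad) : Dyad := if ble a b then a else b

/-- Maximum (exact). [folklore] -/
def max (a b : Dyad) : Dyad := if ble a b then b else a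

/-- Number of bits by which the mantissa `m` exceeds `prec` bits (`0` if `|m| < 2^prec`). [folklore] -/
def excess (prec : ℕ) (m : ℤ) : ℕ := m.natAbs.log2 + 1 - prec

/-- DOWNWARD rounding to a `prec`-bit mantissa: arithmetic right shift (= floor division by `2^s`). [folklore] -/
def roundDown (prec : ℕ) (d : Dyad) : Dyad :=
  if excess prec d.m = 0 then d else ⟨d.m >>> excess prec d.m, d.e + excess prec d.m⟩

/-- UPWARD rounding to a `prec`-bit mantissa (ceiling = negated floor of the negation). [folklore] -/
def roundUp (prec : ℕ) (d : Dyad) : Dyad :=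
  if excess prec d.m = 0 then d else ⟨-((-d.m) >>> excess prec d.m), d.e + excess prec d.m⟩

/-- `0 < 2^k`. [folklore] -/
private theorem two_zpow_pos (k : ℤ) : (0 : ℝ) < (2 : ℝ) ^ k := zpow_pos (by norm_num) k

/-- `toReal (ofInt z) = z`. [folklore] -/
@[simp] theorem toReal_ofInt (z : ℤ) : (ofInt z).toReal = z := by simp [toReal, ofInt]

/-- `toReal (neg d) = - toReal d`. [folklore] -/
@[simp] theorem toReal_neg (d : Dyad) : (neg d).toReal = -d.toReal := by simp [toReal, neg]

/-- `toReal (shift d k) = toReal d · 2^k`. [folklore] -/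
@[simp] theorem toReal_shift (d : Dyad) (k : ℤ) : (shift d k).toReal = d.toReal * (2 : ℝ) ^ k := by
  simp only [toReal, shift]
  rw [zpow_add₀ (by norm_num : (2 : ℝ) ≠ 0)]; ring

/-- `toReal (abs d) = |toReal d|`. [folklore] -/
@[simp] theorem toReal_abs (d : Dyad) : (abs d).toReal = |d.toReal| := by
  simp only [toReal, abs, Int.cast_abs]
  rw [_root_.abs_mul, abs_of_pos (two_zpow_pos d.e)]

/-- The aligned mantissa recovers the value: `mantAt d e · 2^e = toReal d` for `e ≤ d.e`. [folklore] -/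
theorem mantAt_mul_zpow (d : Dyad) {e : ℤ} (he : e ≤ d.e) : (d.mantAt e : ℝ) * (2 : ℝ) ^ e = d.toReal := by
  simp only [mantAt, toReal]
  push_cast
  rw [mul_assoc, ← zpow_natCast, ← zpow_add₀ (by norm_num : (2 : ℝ) ≠ 0), Int.toNat_of_nonneg (by omega)]
  congr 2; ring

/-- `toReal (add a b) = toReal a + toReal b`. [folklore] -/
@[simp] theorem toReal_add (a b : Dyad) : (add a b).toReal = a.toReal + b.toReal := by
  have ha := mantAt_mul_zpow a (_root_.min_le_left a.e b.e)
  have hb := mantAt_mul_zpow b (_root_.min_le_right a.e b.e)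
  simp only [add, toReal] at ha hb ⊢
  push_cast
  linarith [ha, hb]

/-- `toReal (sub a b) = toReal a - toReal b`. [folklore] -/
@[simp] theorem toReal_sub (a b : Dyad) : (sub a b).toReal = a.toReal - b.toReal := by simp [sub, sub_eq_add_neg]

/-- `toReal (mul a b) = toReal a · toReal b`. [folklore] -/
@[simp] theorem toReal_mul (a b : Dyad) : (mul a b).toReal = a.toReal * b.toReal := by
  simp only [toReal, mul, Int.cast_mul]
  rw [zpow_add₀ (by norm_num : (2 : ℝ) ≠ 0)]; ring

/-- `ble a b ↔ toReal a ≤ toReal b`. [folklore] -/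
theorem ble_iff (a b : Dyad) : ble a b = true ↔ a.toReal ≤ b.toReal := by
  have ha := mantAt_mul_zpow a (_root_.min_le_left a.e b.e)
  have hb := mantAt_mul_zpow b (_root_.min_le_right a.e b.e)
  have hp := two_zpow_pos (Min.min a.e b.e)
  rw [ble, decide_eq_true_iff, ← ha, ← hb, mul_le_mul_iff_of_pos_right hp, Int.cast_le]

/-- `blt a b ↔ toReal a < toReal b`. [folklore] -/
theorem blt_iff (a b : Dyad) : blt a b = true ↔ a.toReal < b.toReal := by
  have ha := mantAt_mul_zpow a (_root_.min_le_left a.e b.e)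
  have hb := mantAt_mul_zpow b (_root_.min_le_right a.e b.e)
  have hp := two_zpow_pos (Min.min a.e b.e)
  rw [blt, decide_eq_true_iff, ← ha, ← hb, mul_lt_mul_iff_of_pos_right hp, Int.cast_lt]

/-- `toReal (min a b) = min (toReal a) (toReal b)`. [folklore] -/
@[simp] theorem toReal_min (a b : Dyad) : (Dyad.min a b).toReal = Min.min a.toReal b.toReal := by
  unfold Dyad.min
  by_cases h : ble a b = true
  · rw [if_pos h, min_eq_left ((ble_iff a b).1 h)]
  · rw [if_neg h, min_eq_right (le_of_lt (not_le.1 (fun h' => h ((ble_iff a b).2 h'))))]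

/-- `toReal (max a b) = max (toReal a) (toReal b)`. [folklore] -/
@[simp] theorem toReal_max (a b : Dyad) : (Dyad.max a b).toReal = Max.max a.toReal b.toReal := by
  unfold Dyad.max
  by_cases h : ble a b = true
  · rw [if_pos h, max_eq_right ((ble_iff a b).1 h)]
  · rw [if_neg h, max_eq_left (le_of_lt (not_le.1 (fun h' => h ((ble_iff a b).2 h'))))]

/-- **Downward rounding is below the value.** [folklore] -/
theorem roundDown_le (prec : ℕ) (d : Dyad) : (roundDown prec d).toReal ≤ d.toReal := by
  unfold roundDown
  split_ifs with h
  · exact le_rfl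
  · set s := excess prec d.m
    have h2s : (0 : ℤ) < ((2 ^ s : ℕ) : ℤ) := by positivity
    have hfl := Numerics.fdiv_mul_le_real (a := d.m) h2s
    have key := mul_le_mul_of_nonneg_right hfl (two_zpow_pos d.e).le
    simp only [toReal, Int.shiftRight_eq_div_pow]
    push_cast at key ⊢
    rw [zpow_add₀ (by norm_num : (2 : ℝ) ≠ 0), zpow_natCast]
    linarith [key]

/-- **Upward rounding is above the value.** [folklore] -/
theorem le_roundUp (prec : ℕ) (d : Dyad) : d.toReal ≤ (roundUp prec d).toReal := by
  unfold roundUp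
  split_ifs with h
  · exact le_rfl
  · set s := excess prec d.m
    have h2s : (0 : ℤ) < ((2 ^ s : ℕ) : ℤ) := by positivity
    have hce := Numerics.le_cdiv_mul_real (a := d.m) h2s
    have key := mul_le_mul_of_nonneg_right hce (two_zpow_pos d.e).le
    simp only [Numerics.cdiv] at key
    simp only [toReal, Int.shiftRight_eq_div_pow]
    push_cast at key ⊢
    rw [zpow_add₀ (by norm_num : (2 : ℝ) ≠ 0), zpow_natCast]
    linarith [key]

end Dyad

/-! ### Dyadic floating intervals -/

/-- An interval with dyadic floating endpoints. [folklore] -/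
structure IntervalD where
  /-- lower endpoint -/
  lo : Dyad
  /-- upper endpoint -/
  hi : Dyad
  deriving DecidableEq, Repr

namespace IntervalD

/-- Membership `lo ≤ x ≤ hi` of a real number. [folklore] -/
def mem (x : ℝ) (I : IntervalD) : Prop := I.lo.toReal ≤ x ∧ x ≤ I.hi.toReal

/-- The point interval of a dyadic number. [folklore] -/
def ofDyad (d : Dyad) : IntervalD := ⟨d, d⟩

/-- The point interval of an integer. [folklore] -/
def ofInt (z : ℤ) : IntervalD := ofDyad (Dyad.ofInt z)

/-- **Outward rounding** to `prec`-bit mantissas: floor below, ceiling above. [folklore] -/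
def roundOut (prec : ℕ) (I : IntervalD) : IntervalD := ⟨I.lo.roundDown prec, I.hi.roundUp prec⟩

/-- Negation (exact). [folklore] -/
def neg (I : IntervalD) : IntervalD := ⟨I.hi.neg, I.lo.neg⟩

/-- Sum (exact). [folklore] -/
def add (I J : IntervalD) : IntervalD := ⟨I.lo.add J.lo, I.hi.add J.hi⟩

/-- Difference (exact). [folklore] -/
def sub (I J : IntervalD) : IntervalD := ⟨I.lo.sub J.hi, I.hi.sub J.lo⟩

/-- Product (Moore's four-corner product, exact). [folklore] -/
def mul (I J : IntervalD) : IntervalD :=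
  let p1 := I.lo.mul J.lo
  let p2 := I.lo.mul J.hi
  let p3 := I.hi.mul J.lo
  let p4 := I.hi.mul J.hi
  ⟨Dyad.min (Dyad.min p1 p2) (Dyad.min p3 p4), Dyad.max (Dyad.max p1 p2) (Dyad.max p3 p4)⟩

/-- Square (exact, sign-tight: the lower endpoint is `0` when `0 ∈ I`). [folklore] -/
def sqr (I : IntervalD) : IntervalD :=
  if Dyad.ble (Dyad.ofInt 0) I.lo then ⟨I.lo.mul I.lo, I.hi.mul I.hi⟩
  else if Dyad.ble I.hi (Dyad.ofInt 0) then ⟨I.hi.mul I.hi, I.lo.mul I.lo⟩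
  else ⟨Dyad.ofInt 0, Dyad.max (I.lo.mul I.lo) (I.hi.mul I.hi)⟩

/-- Product with a dyadic scalar (exact). [folklore] -/
def mulDyad (I : IntervalD) (d : Dyad) : IntervalD :=
  if 0 ≤ d.m then ⟨I.lo.mul d, I.hi.mul d⟩ else ⟨I.hi.mul d, I.lo.mul d⟩

/-- Rescaling by `2^k` (exact). [folklore] -/
def shift (I : IntervalD) (k : ℤ) : IntervalD := ⟨I.lo.shift k, I.hi.shift k⟩

/-- Interval hull of two intervals. [folklore] -/
def hull (I J : IntervalD) : IntervalD := ⟨Dyad.min I.lo J.lo, Dyad.max I.hi J.hi⟩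

/-- Rounded sum. [folklore] -/
def addR (prec : ℕ) (I J : IntervalD) : IntervalD := roundOut prec (add I J)

/-- Rounded difference. [folklore] -/
def subR (prec : ℕ) (I J : IntervalD) : IntervalD := roundOut prec (sub I J)

/-- Rounded product. [folklore] -/
def mulR (prec : ℕ) (I J : IntervalD) : IntervalD := roundOut prec (mul I J)

/-- Rounded square. [folklore] -/
def sqrR (prec : ℕ) (I : IntervalD) : IntervalD := roundOut prec (sqr I)

/-- TEST `I ⊆ J`. [folklore] -/
def subset (I J : IntervalD) : Bool := Dyad.ble J.lo I.lo && Dyad.ble I.hi J.hi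

/-- TEST `hi I ≤ d`. [folklore] -/
def hiLe (I : IntervalD) (d : Dyad) : Bool := Dyad.ble I.hi d

/-- TEST `d ≤ lo I`. [folklore] -/
def leLo (d : Dyad) (I : IntervalD) : Bool := Dyad.ble d I.lo

/-- Magnitude bound `max (|lo|, |hi|)`. [folklore] -/
def mag (I : IntervalD) : Dyad := Dyad.max I.lo.abs I.hi.abs

/-! #### Inclusion theorems -/

variable {x y : ℝ} {I J : IntervalD}

/-- [folklore] -/
theorem mem_ofDyad (d : Dyad) : mem d.toReal (ofDyad d) := ⟨le_rfl, le_rfl⟩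

/-- [folklore] -/
theorem mem_ofInt (z : ℤ) : mem (z : ℝ) (ofInt z) := by
  have h := mem_ofDyad (Dyad.ofInt z); rw [Dyad.toReal_ofInt] at h; exact h

/-- **The rounding lemma**: outward rounding preserves membership. [folklore] -/
theorem mem_roundOut (prec : ℕ) (hx : mem x I) : mem x (roundOut prec I) :=
  ⟨(Dyad.roundDown_le prec I.lo).trans hx.1, hx.2.trans (Dyad.le_roundUp prec I.hi)⟩

/-- [folklore] -/
theorem mem_neg (hx : mem x I) : mem (-x) (neg I) := by
  simp only [mem, neg, Dyad.toReal_neg] at hx ⊢; constructor <;> linarith [hx.1, hx.2]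

/-- [folklore] -/
theorem mem_add (hx : mem x I) (hy : mem y J) : mem (x + y) (add I J) := by
  simp only [mem, add, Dyad.toReal_add] at hx hy ⊢; constructor <;> linarith [hx.1, hx.2, hy.1, hy.2]

/-- [folklore] -/
theorem mem_sub (hx : mem x I) (hy : mem y J) : mem (x - y) (sub I J) := by
  simp only [mem, sub, Dyad.toReal_sub] at hx hy ⊢; constructor <;> linarith [hx.1, hx.2, hy.1, hy.2]

/-- [folklore] -/
theorem mem_mul (hx : mem x I) (hy : mem y J) : mem (x * y) (mul I J) := by
  obtain ⟨h1, h2⟩ := Numerics.FI.mul_mem_corners hx hy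
  refine ⟨?_, ?_⟩ <;> simp only [mul, Dyad.toReal_min, Dyad.toReal_max, Dyad.toReal_mul]
  exacts [h1, h2]

/-- [folklore] -/
theorem mem_sqr (hx : mem x I) : mem (x ^ 2) (sqr I) := by
  obtain ⟨h1, h2⟩ := hx
  unfold sqr
  split_ifs with hlo hhi
  · have h0 : 0 ≤ I.lo.toReal := by have h := (Dyad.ble_iff _ _).1 hlo; simpa using h
    refine ⟨?_, ?_⟩ <;> simp only [Dyad.toReal_mul] <;> nlinarith
  · have h0 : I.hi.toReal ≤ 0 := by have h := (Dyad.ble_iff _ _).1 hhi; simpa using h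
    refine ⟨?_, ?_⟩ <;> simp only [Dyad.toReal_mul] <;> nlinarith
  · refine ⟨?_, ?_⟩
    · simp only [Dyad.toReal_ofInt, Int.cast_zero]; exact sq_nonneg x
    · simp only [Dyad.toReal_max, Dyad.toReal_mul]
      rcases le_total 0 x with h0 | h0
      · exact (le_max_right _ _).trans' (by nlinarith)
      · exact (le_max_left _ _).trans' (by nlinarith)

/-- [folklore] -/
theorem mem_mulDyad (hx : mem x I) (d : Dyad) : mem (x * d.toReal) (mulDyad I d) := by
  obtain ⟨h1, h2⟩ := hx
  unfold mulDyad
  have hd : d.toReal = (d.m : ℝ) * (2 : ℝ) ^ d.e := rfl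
  have hp : (0 : ℝ) < (2 : ℝ) ^ d.e := zpow_pos (by norm_num) _
  split_ifs with hm
  · have h0 : 0 ≤ d.toReal := by rw [hd]; exact mul_nonneg (by exact_mod_cast hm) hp.le
    simp only [mem, Dyad.toReal_mul]
    exact ⟨mul_le_mul_of_nonneg_right h1 h0, mul_le_mul_of_nonneg_right h2 h0⟩
  · have h0 : d.toReal ≤ 0 := by
      rw [hd]; exact mul_nonpos_of_nonpos_of_nonneg (by exact_mod_cast (not_le.1 hm).le) hp.le
    simp only [mem, Dyad.toReal_mul]
    exact ⟨mul_le_mul_of_nonpos_right h2 h0, mul_le_mul_of_nonpos_right h1 h0⟩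

/-- [folklore] -/
theorem mem_shift (hx : mem x I) (k : ℤ) : mem (x * (2 : ℝ) ^ k) (shift I k) := by
  have hp : (0 : ℝ) < (2 : ℝ) ^ k := zpow_pos (by norm_num) _
  simp only [mem, shift, Dyad.toReal_shift]
  exact ⟨mul_le_mul_of_nonneg_right hx.1 hp.le, mul_le_mul_of_nonneg_right hx.2 hp.le⟩

/-- [folklore] -/
theorem mem_hull_left (hx : mem x I) (J : IntervalD) : mem x (hull I J) := by
  simp only [mem, hull, Dyad.toReal_min, Dyad.toReal_max]
  exact ⟨(min_le_left _ _).trans hx.1, hx.2.trans (le_max_left _ _)⟩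

/-- [folklore] -/
theorem mem_hull_right (hx : mem x J) (I : IntervalD) : mem x (hull I J) := by
  simp only [mem, hull, Dyad.toReal_min, Dyad.toReal_max]
  exact ⟨(min_le_right _ _).trans hx.1, hx.2.trans (le_max_right _ _)⟩

/-- [folklore] -/
theorem mem_addR (prec : ℕ) (hx : mem x I) (hy : mem y J) : mem (x + y) (addR prec I J) :=
  mem_roundOut prec (mem_add hx hy)

/-- [folklore] -/
theorem mem_subR (prec : ℕ) (hx : mem x I) (hy : mem y J) : mem (x - y) (subR prec I J) :=
  mem_roundOut prec (mem_sub hx hy)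

/-- [folklore] -/
theorem mem_mulR (prec : ℕ) (hx : mem x I) (hy : mem y J) : mem (x * y) (mulR prec I J) :=
  mem_roundOut prec (mem_mul hx hy)

/-- [folklore] -/
theorem mem_sqrR (prec : ℕ) (hx : mem x I) : mem (x ^ 2) (sqrR prec I) :=
  mem_roundOut prec (mem_sqr hx)

/-- [folklore] -/
theorem mem_of_subset (h : subset I J = true) (hx : mem x I) : mem x J := by
  simp only [subset, Bool.and_eq_true, Dyad.ble_iff] at h
  exact ⟨h.1.trans hx.1, hx.2.trans h.2⟩

/-- [folklore] -/
theorem le_of_hiLe {d : Dyad} (h : hiLe I d = true) (hx : mem x I) : x ≤ d.toReal :=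
  hx.2.trans ((Dyad.ble_iff _ _).1 h)

/-- [folklore] -/
theorem le_of_leLo {d : Dyad} (h : leLo d I = true) (hx : mem x I) : d.toReal ≤ x :=
  ((Dyad.ble_iff _ _).1 h).trans hx.1

/-- [folklore] -/
theorem abs_le_mag (hx : mem x I) : |x| ≤ (mag I).toReal := by
  simp only [mag, Dyad.toReal_max, Dyad.toReal_abs]
  rcases le_total 0 x with h0 | h0
  · rw [abs_of_nonneg h0]
    exact (le_max_right _ _).trans' (hx.2.trans (le_abs_self _))
  · rw [abs_of_nonpos h0]
    exact (le_max_left _ _).trans' ((neg_le_neg hx.1).trans (neg_le_abs _))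

end IntervalD

end Summit.NavierStokesRegularity.NavierStokesRegularity.Theorems.TaylorModelCert
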